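import Mathlib
import Literature.NumberTheory.Automorphic.HigherGreenFunctionProofs
import Literature.NumberTheory.Automorphic.ZhouLegendreGreenValues
import Literature.Analysis.PDE.HopfLemmas
import HarnessLib

/-!
# CM values of higher Green functions: the normalised value `(d₁d₂)^{(k-1)/2} G_k^{Γ₀(N)}(z₁, z₂)`,
the analytic characterisation of `G_k^{Γ₀(N)}`, and Zhang's archimedean height formula

Definition request `higherGreenFunctionCM` of route `KontsevichZagierPeriods/TorsionLogsGKZ`
(item stmt-KontsevichZagierPeriods-4444; cruxes 4040, 4041, 4454). Most of the request is already in
the tree and is only *named* here: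

* the higher Green function `G_k^{Γ₀(N)}(z₁, z₂) = -2 Σ_{γ ∈ Γ₀(N)} Q_{k-1}(1 + |z₁ - γz₂|²/(2 Im z₁ Im γz₂))`
  is `higherGreen N k 1` of `HigherGreenFunction.lean` (Bruinier–Li–Yang 2025, (1.1): the sum runs
  over ALL of `Γ₀(N) ≤ SL₂(ℤ)`, so it is TWICE the function of Gross–Zagier 1986 §II.2 / §V.4,
  Zhang 1997 §3.4 and Zhou 2015 eq. (auto_Green_defn_Q_nu), which sum over `Γ₀(N)/{±1}`); here
  `higherGreenFunction N k := higherGreen N k 1`;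
* CM points of discriminant `d`: `IsCMPointOfDisc z d` (ibid.);
* (F1) Bruinier–Li–Yang 2025 Thm 1.4 (Conjecture 1.1 holds): the named fact `GKZAlgebraicity` (ibid.);
* (F2) Zhou 2015 Remark 9 (three weight-4 CM values as `∫₀¹ P_ν²`): the named fact
  `Zhou2015_legendreP_sq_integral` of `ZhouLegendreGreenValues.lean`.

What this file adds.

1. `higherGreenFunctionCM N k d₁ d₂ z₁ z₂ := |d₁d₂|^{(k-1)/2} · G_k^{Γ₀(N)}(z₁, z₂)` (tree normalisation),
   the **normalised CM value**: the Gross–Zagier / Gross–Kohnen–Zagier conjecture (Gross–Zagier 1986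
   §V.4, Gross–Kohnen–Zagier 1987 §V.1; in the form of Viazovska, arXiv:1110.4654 §1:
   "`G_{k,λ}(𝔷₁, 𝔷₂) = (D₁D₂)^{(1-k)/2} log α`", and of Bruinier–Li–Yang 2025 Conj. 1.1:
   "`G_{r+1,f}(z₁, z₂) = |d₁d₂|^{-r/2} log|α|`", `k = r + 1`) says that this number is `log|α|`,
   `α ∈ ℚ̄ˣ`, whenever `q⁻¹` is the principal part of a form in `M^{!,∞}_{2-2k}(Γ₀(N))` (e.g. when
   `S_{2k}(Γ₀(N)) = 0`, the "cusp-form-free" case of Zhou 2015, p. 3). Proved API: `Γ₀(N)`-invariance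
   in both variables, symmetry, the cusp-form-free corollary of `GKZAlgebraicity`
   (`higherGreenFunctionCM_eq_log_of_GKZ`), and — from Zhou's fact — the three values
   `-48 log(2+√3)` (level 1, `(ρ, i)`, `d = -3, -4`), `-32 log(1+√2)` (level 2, `d = -4, -8`),
   `-24 log 2` (level 3, `d = -3, -12`), logarithms of the algebraic numbers `(2+√3)^{-48}`,
   `(1+√2)^{-32}`, `2^{-24}` as the conjecture predicts (`S₄(Γ₀(N)) = 0` for `N ≤ 5`); the six points
   are shown to be CM points of the stated discriminants.
2. The **analytic characterisation** of `G_k^{Γ₀(N)}` (Gross–Zagier 1986 §II.2; Zhang 1997 p. 132: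
   "(a) `G_k(z, z')` is killed by `D - k(k-1)` operating on the first variable, `D = y²(∂²/∂x² + ∂²/∂y²)`;
   (b) `G_k(z, z') = log|z - z'|² + O(1)` as `z → z'`; (c) in a neighbourhood of a cusp `γ⁻¹∞` the function
   `Im(γz)^{k-1} G_k(z, z')` extends to a continuous function. We claim that these properties characterize
   `G_k(z, z')` uniquely"; Bruinier–Li–Yang 2025 p. 3: "It is an eigenfunction with respect to the
   Laplacians in `z₁` and `z₂` […] vanishes when one of the `zᵢ` approaches the cusps, and has a
   logarithmic singularity along the diagonal. In fact, these properties characterize it uniquely"):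
   the predicate `IsResolventGreenLike N k z' F` ((a), (c) and `Γ₀(N)`-invariance for `F : ℍ → ℝ` off
   the orbit `Γ₀(N)z'`, with the hyperbolic Laplacian `realHypLaplacian` = `y²·`(Mathlib's Euclidean
   Laplacian), Iwaniec's sign as in the tree's `hypLaplacian`), and two NAMED FACTS:
   `resolventGreen_unique` (two such functions whose difference is bounded near `z'` coincide; `k ≥ 2`)
   and `higherGreen_isResolventGreenLike` (`z ↦ G_k^{Γ₀(N)}(z, z')` has these properties, with
   singularity `n_{z'} log|z - z'|² + O(1)`, `n_{z'} = #Stab_{Γ₀(N)}(z')` counted in `SL₂(ℤ)`, i.e. `2`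
   at a non-elliptic `z'` — each stabiliser element contributes one singular term `-2Q_{k-1} ∼ log|z-z'|²`
   of the defining series).
3. (F3) **Zhang 1997, Prop. 3.4.1 / 4.1.2**: for CM points `x ≠ y` of `X₀(N)` the archimedean local
   height pairing of the CM cycles `S_k(x)`, `S_k(y)` on the Kuga–Sato variety is `½ G_k(x, y)` (Zhang's
   `G_k = Σ_{γ ∈ Γ₀(N)/±1} g_k`, i.e. `¼ · higherGreen N k 1 x y`). The pairing itself — Gillet–Soulé
   arithmetic intersection `(-1)^k (Ŝ_k(x) · Ŝ_k(y))_v` with normalised Green currents on `Y_k(N)(ℂ)`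
   (Zhang 1997 §1.3, (3.1.1), (3.2.2), (3.4.3)–(3.4.4)) — is not constructible in Mathlib (no currents,
   no arithmetic Chow groups; the tree's `KugaSatoVariety` is a scheme-side structure only). Following
   the tree's idiom for canonical-but-unconstructed objects (`KugaSatoVariety`, `SmallEigenbasis`,
   `ModularParametrizationData`) it is recorded as the hypothesis structure
   `Zhang1997.ArchCMHeightPairing N k`: the function `H_k(x, y)` of Zhang (3.4.3) together with exactly
   the properties Zhang establishes for it in §3.4–3.5 (it satisfies (a), (c), is `Γ₀(N)`-invariant, and
   has the singularity (b) of `½ G_k`, "already shown in the formulas in Sect. 1.4"). Zhang's proof of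
   Prop. 3.4.1 is then the uniqueness claim, and `zhang_heegnerCycles_height` is PROVED here in that
   form: `resolventGreen_unique → higherGreen_isResolventGreenLike → H.pair x y = ¼ · higherGreen N k 1 x y`.
4. **`resolventGreen_unique` is proved** (`resolventGreen_unique_holds`, §4): Zhang's `L²`-negativity
   of `D - k(k-1)` and the removable-singularity step are replaced by their maximum-principle form —
   the second-order condition `Δₑ ≤ 0` at an interior maximum, an `ε log |z - z'|` barrier at the
   bounded singularities, and compactness of `X₀(N)` away from the cusps (finite index of `Γ₀(N)`,
   Mathlib's truncated fundamental domain, proper discontinuity of `SL₂(ℤ)` on `ℍ`).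

Not here. (F4) Zhou 2015 Thm 1.2.1 / Prop 2.2.2 (Kontsevich–Zagier integral representations of
`G_{k/2}^{ℌ/Γ̄₀(N)}` for `dim S_k(Γ₀(N)) = 0` through `E₂, E₄, E₆, η, α_N, R_ν`): optional in the request
and not vendored — it needs the non-holomorphic `E₂`, `α_N = {1 + N^{-6/(N-1)}(η(z)/η(Nz))^{24/(N-1)}}⁻¹`
and Zhou's `R_ν`, none of which the tree has; the three CM values the route actually consumes are (F2).
The 3-dimensional Euler–Fubini rewriting `J₁ = 4π² ∫₀¹ P_{-1/6}²`, `J₃ = (4π²/3) ∫₀¹ P_{-1/3}²` of items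
4040/4041 is a proof obligation on top of `LegendreP.euler_integral_ordinaryHypergeometric`
(`ZhouLegendreGreenValuesProofs.lean`), left to a proofs file. Heegner *divisors* / traces over
`Γ₀(N)`-classes (Gross–Kohnen–Zagier's `P_d`) are not needed by the route and not defined.

## References

* [Zhang1997] S.-W. Zhang, *Heights of Heegner cycles and derivatives of L-series*, Invent. Math.
  130 (1997) 99–152, doi:10.1007/s002220050179 (read: pp. 100, 124–126, 130–132, 139–140):
  (3.1.1), (3.2.2), §3.4 (definition of `g_k`, `G_k`, Prop. 3.4.1, (3.4.3)–(3.4.5), properties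
  (a)–(c) and the uniqueness claim, p. 132), §3.5, Prop. 4.1.2.
* [GrossZagier1986] B. Gross, D. Zagier, Invent. Math. 84 (1986), §II.2 (pp. 238–239: `g_s`, `G_{N,s}`
  and its characterisation), §V.4 (the conjecture). [held copy has no text layer; statements taken
  from Zhang 1997 §3.4 and Bruinier–Li–Yang 2025 p. 3, which restate them]
* [GrossKohnenZagier1987] B. Gross, W. Kohnen, D. Zagier, Math. Ann. 278 (1987), §V.1.
* [BruinierLiYang2025] J. Bruinier, Y. Li, T. Yang, Forum Math. Sigma 13 (2025), arXiv:2204.10604,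
  p. 3 ((1.1)–(1.3), characterisation sentence, Conj. 1.1), Thm. 1.4.
* [Zhou2015] Y. Zhou, Ramanujan J. 38 (2015), arXiv:1312.6352, p. 3 (eq. (auto_Green_defn_Q_nu),
  cusp-form-free GKZ conjecture), Remark 9 (p. 19).
* M. Viazovska, *CM values of higher Green's functions*, arXiv:1110.4654, §1 (characterisation
  (i)–(v); the conjecture with `(D₁D₂)^{(1-k)/2}`).
* [Iwaniec2002] H. Iwaniec, *Spectral methods of automorphic forms*, (1.19) (sign of `Δ`).
* D. Gilbarg, N. S. Trudinger, *Elliptic partial differential equations of second order* (2001),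
  §3.1, Thm. 3.1 and Cor. 3.2 (weak maximum principle for `Lu = Δu + cu`, `c ≤ 0`) — §4 below.
* S. Axler, P. Bourdon, W. Ramey, *Harmonic Function Theory*, GTM 137, Thm. 2.3 (the `ε log`
  barrier for bounded isolated singularities) — §4 below.
* [DiamondShurman2005] F. Diamond, J. Shurman, *A first course in modular forms*, GTM 228 (2005),
  Prop. 2.1.1, Lemma 2.3.1, §2.4 (proper discontinuity, `ℍ = Γ · R · 𝒟`) — §4 below.
-/

noncomputable section

namespace Literature.NumberTheory.Automorphic

open UpperHalfPlane Complex CongruenceSubgroup Laplacian Filter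
open scoped MatrixGroups Real Topology

/-! ## 1. `G_k^{Γ₀(N)}` and its normalised CM values -/

/-- The **higher Green function** `G_k^{Γ₀(N)} : ℍ × ℍ → ℝ` of integral weight parameter `k`
(a higher Green function proper for `k ≥ 2`), in the tree's normalisation
`G_k^{Γ₀(N)}(z₁, z₂) = -2 Σ_{γ ∈ Γ₀(N)} Q_{k-1}(1 + |z₁ - γz₂|²/(2 Im z₁ Im γz₂))` summed over all of
`Γ₀(N) ≤ SL₂(ℤ)` (Bruinier–Li–Yang 2025, (1.1)) — this is `higherGreen N k 1` (`R_N^{(1)} = Γ₀(N)`,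
`coe_mem_heckeMatrices_one_iff`), and twice the function `Σ_{γ ∈ Γ₀(N)/±1}` of Gross–Zagier 1986
§II.2, Zhang 1997 §3.4 and Zhou 2015 (`G^{ℌ/Γ̄₀(N)}_{k} = ½ · higherGreenFunction N k`, Zhou's
subscript being `k = weight/2`). [cite: BruinierLiYang2025, (1.1)] -/
abbrev higherGreenFunction (N k : ℕ) : ℍ → ℍ → ℝ :=
  higherGreen N k 1

/-- Unfolding `higherGreenFunction`. [cite: BruinierLiYang2025, (1.1)] -/
theorem higherGreenFunction_apply (N k : ℕ) (z₁ z₂ : ℍ) :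
    higherGreenFunction N k z₁ z₂ = higherGreen N k 1 z₁ z₂ :=
  rfl

/-- The **normalised CM value of the higher Green function**:
`higherGreenFunctionCM N k d₁ d₂ z₁ z₂ := |d₁ d₂|^{(k-1)/2} · G_k^{Γ₀(N)}(z₁, z₂)` (tree normalisation of
`G_k`), the quantity which the conjecture of Gross–Zagier (1986, §V.4) and Gross–Kohnen–Zagier
(1987, §V.1) — "`G_{k,λ}(𝔷₁, 𝔷₂) = (D₁D₂)^{(1-k)/2} log α`, `α ∈ ℚ̄`" (Viazovska 2011, §1), equivalently
"`G_{r+1,f}(z₁, z₂) = |d₁d₂|^{-r/2} log|α|`" (Bruinier–Li–Yang 2025, Conj. 1.1, `k = r + 1`) —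
predicts to be the logarithm of (the absolute value of) an algebraic number when `zⱼ` is a CM point of
discriminant `dⱼ` and `q⁻¹ + O(1)` is a weakly holomorphic form of weight `2 - 2k` for `Γ₀(N)` (the
cusp-form-free case `S_{2k}(Γ₀(N)) = 0`; see `higherGreenFunctionCM_eq_log_of_GKZ`). The
discriminants are parameters: the intended use is with `IsCMPointOfDisc zⱼ dⱼ` (then `d₁d₂ > 0`).
A different normalisation of `G_k` (e.g. Gross–Zagier's, half of ours) changes the value by a rational
factor, hence `α` by a rational power. [cite: BruinierLiYang2025, Conj. 1.1] -/
def higherGreenFunctionCM (N k : ℕ) (d₁ d₂ : ℤ) (z₁ z₂ : ℍ) : ℝ :=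
  |((d₁ * d₂ : ℤ) : ℝ)| ^ (((k : ℝ) - 1) / 2) * higherGreen N k 1 z₁ z₂

/-- Unfolding `higherGreenFunctionCM`. [cite: BruinierLiYang2025, Conj. 1.1] -/
theorem higherGreenFunctionCM_def (N k : ℕ) (d₁ d₂ : ℤ) (z₁ z₂ : ℍ) :
    higherGreenFunctionCM N k d₁ d₂ z₁ z₂ =
      |((d₁ * d₂ : ℤ) : ℝ)| ^ (((k : ℝ) - 1) / 2) * higherGreen N k 1 z₁ z₂ :=
  rfl

/-- `Γ₀(N)`-invariance in the first variable (the value lives on `X₀(N) × X₀(N)`), from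
`higherGreen_smul_left`. [cite: BruinierLiYang2025, (1.1)–(1.2)] -/
theorem higherGreenFunctionCM_smul_left {N : ℕ} (k : ℕ) (d₁ d₂ : ℤ) {γ : SL(2, ℤ)}
    (hγ : γ ∈ Gamma0 N) (z₁ z₂ : ℍ) :
    higherGreenFunctionCM N k d₁ d₂ (γ • z₁) z₂ = higherGreenFunctionCM N k d₁ d₂ z₁ z₂ := by
  rw [higherGreenFunctionCM, higherGreenFunctionCM, higherGreen_smul_left one_ne_zero hγ]

/-- `Γ₀(N)`-invariance in the second variable, from `higherGreen_smul_right`.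
[cite: BruinierLiYang2025, (1.1)–(1.2)] -/
theorem higherGreenFunctionCM_smul_right {N : ℕ} (k : ℕ) (d₁ d₂ : ℤ) {γ : SL(2, ℤ)}
    (hγ : γ ∈ Gamma0 N) (z₁ z₂ : ℍ) :
    higherGreenFunctionCM N k d₁ d₂ z₁ (γ • z₂) = higherGreenFunctionCM N k d₁ d₂ z₁ z₂ := by
  rw [higherGreenFunctionCM, higherGreenFunctionCM, higherGreen_smul_right one_ne_zero hγ]

/-- Symmetry `(d₁, z₁) ↔ (d₂, z₂)`, from `higherGreen_symm`. [cite: BruinierLiYang2025, (1.2)] -/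
theorem higherGreenFunctionCM_symm (N k : ℕ) (d₁ d₂ : ℤ) (z₁ z₂ : ℍ) :
    higherGreenFunctionCM N k d₁ d₂ z₁ z₂ = higherGreenFunctionCM N k d₂ d₁ z₂ z₁ := by
  rw [higherGreenFunctionCM, higherGreenFunctionCM, higherGreen_symm one_pos, mul_comm d₁ d₂]

/-- **The cusp-form-free case of the Gross–Kohnen–Zagier conjecture, from `GKZAlgebraicity`.**
If `f = q⁻¹ + O(1) ∈ M^{!,∞}_{-2r}(Γ₀(N))` has rational coefficients (`c(-1) = 1`, `c(-m) = 0` for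
`m ≥ 2`; when `λ = (1, 0, 0, …)` is a relation for `S_{2r+2}(Γ₀(N))` — in particular when
`S_{2r+2}(Γ₀(N)) = 0` — such an `f` exists by Serre duality, Bruinier–Li–Yang 2025 Remark 2.5, and is
unique with rational coefficients since there are no non-zero holomorphic forms of negative weight),
then `G_{r+1,f} = G_{r+1}^{Γ₀(N)}` ((1.3) has the single term `m = 1`) and Conjecture 1.1 of
Bruinier–Li–Yang 2025 (a theorem: `GKZAlgebraicity`) gives, for CM points `z₁, z₂` of discriminants
`d₁, d₂` off the diagonal `T₁`, an `α ∈ ℚ̄ˣ` with `|d₁d₂|^{r/2} G_{r+1}^{Γ₀(N)}(z₁, z₂) = log|α|` —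
Zhou 2015, p. 3: "In the absence of holomorphic cusp forms […] it has been postulated that the values
of the automorphic Green's function at CM points are expressible in terms of the logarithms of
certain algebraic numbers". [cite: BruinierLiYang2025, Conj. 1.1, Thm. 1.4 and Remark 2.5] -/
theorem higherGreenFunctionCM_eq_log_of_GKZ (h : GKZAlgebraicity) {N r : ℕ} (hN : 0 < N)
    (hr : 0 < r) {f : ℍ → ℂ} {c : ℤ → ℚ} (hf : IsRatWeaklyHolomorphicForm N (-2 * (r : ℤ)) f c)
    (hc1 : c (-1) = 1) (hc : ∀ m : ℤ, m < -1 → c m = 0) {z₁ z₂ : ℍ} {d₁ d₂ : ℤ}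
    (h₁ : IsCMPointOfDisc z₁ d₁) (h₂ : IsCMPointOfDisc z₂ d₂) (hT : ¬ OnHeckeCorrespondence N 1 z₁ z₂) :
    ∃ α : ℂ, IsAlgebraic ℚ α ∧ α ≠ 0 ∧
      higherGreenFunctionCM N (r + 1) d₁ d₂ z₁ z₂ = Real.log ‖α‖ := by
  have hoff : ∀ m : ℕ+, c (-(m : ℤ)) ≠ 0 → ¬ OnHeckeCorrespondence N (m : ℤ) z₁ z₂ := by
    intro m hm
    by_cases hm1 : (m : ℕ) = 1
    · have : (m : ℤ) = 1 := by exact_mod_cast hm1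
      rw [this]; exact hT
    · exfalso
      apply hm
      apply hc
      have h0 : 0 < (m : ℕ) := m.pos
      omega
  obtain ⟨α, hα, hα0, hG⟩ := h N r hN hr f c hf z₁ z₂ d₁ d₂ h₁ h₂ hoff
  refine ⟨α, hα, hα0, ?_⟩
  -- `G_{r+1,f} = c(-1) · 1^r · G_{r+1}^{Γ₀(N), 1} = G_{r+1}^{Γ₀(N)}`
  have hsum := principalHigherGreen_eq_sum (N := N) (r := r) (M := 1) (c := c)
    (fun m hm => hc m (by omega)) z₁ z₂
  rw [Finset.Icc_self, Finset.sum_singleton] at hsum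
  simp only [Nat.cast_one, one_pow, mul_one, hc1, Rat.cast_one, one_mul] at hsum
  -- `|d₁d₂| > 0`
  have hd₁ := h₁.disc_neg
  have hd₂ := h₂.disc_neg
  have hD : 0 < |((d₁ * d₂ : ℤ) : ℝ)| := by
    rw [abs_pos]
    exact_mod_cast (mul_pos_of_neg_of_neg hd₁ hd₂).ne'
  rw [higherGreenFunctionCM, ← hsum, hG, ← mul_assoc, ← Real.rpow_add hD]
  have : ((r + 1 : ℕ) : ℝ) - 1 = r := by push_cast; ring
  rw [this, show (r : ℝ) / 2 + -(r : ℝ) / 2 = 0 by ring, Real.rpow_zero, one_mul]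

/-! ### The six CM points of Zhou's Remark 9 and the three normalised values -/

/-- `ρ = (1 + i√3)/2` is a CM point of discriminant `-3` (root of `z² - z + 1`). [folklore] -/
theorem isCMPointOfDisc_cmRho : IsCMPointOfDisc cmRho (-3) := by
  refine ⟨1, -1, 1, one_pos, by decide, ?_, by norm_num⟩
  have h3 : (√3 : ℝ) ^ 2 = 3 := Real.sq_sqrt (by norm_num)
  have hz : ((cmRho : ℍ) : ℂ) = ⟨1 / 2, √3 / 2⟩ := rfl
  rw [hz]
  apply Complex.ext <;> simp [sq] <;> nlinarith [h3]

/-- `i` is a CM point of discriminant `-4` (root of `z² + 1`). [folklore] -/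
theorem isCMPointOfDisc_I : IsCMPointOfDisc UpperHalfPlane.I (-4) := by
  refine ⟨1, 0, 1, one_pos, by decide, ?_, by norm_num⟩
  simp

/-- `(i - 1)/2` is a CM point of discriminant `-4` (root of `2z² + 2z + 1`). [folklore] -/
theorem isCMPointOfDisc_cmLevelTwo : IsCMPointOfDisc cmLevelTwo (-4) := by
  refine ⟨2, 2, 1, two_pos, by decide, ?_, by norm_num⟩
  have hz : ((cmLevelTwo : ℍ) : ℂ) = ⟨-1 / 2, 1 / 2⟩ := rfl
  rw [hz]
  apply Complex.ext
  · norm_num [sq]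
  · norm_num [sq]

/-- `i/√2` is a CM point of discriminant `-8` (root of `2z² + 1`). [folklore] -/
theorem isCMPointOfDisc_cmLevelTwo' : IsCMPointOfDisc cmLevelTwo' (-8) := by
  refine ⟨2, 0, 1, two_pos, by decide, ?_, by norm_num⟩
  have h2 : (√2 : ℝ) ^ 2 = 2 := Real.sq_sqrt (by norm_num)
  have hz : ((cmLevelTwo' : ℍ) : ℂ) = ⟨0, 1 / √2⟩ := rfl
  rw [hz]
  apply Complex.ext
  · simp [sq]
    field_simp
    nlinarith [h2]
  · simp [sq]

/-- `(3 + i√3)/6` is a CM point of discriminant `-3` (root of `3z² - 3z + 1`). [folklore] -/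
theorem isCMPointOfDisc_cmLevelThree : IsCMPointOfDisc cmLevelThree (-3) := by
  refine ⟨3, -3, 1, by norm_num, by decide, ?_, by norm_num⟩
  have h3 : (√3 : ℝ) ^ 2 = 3 := Real.sq_sqrt (by norm_num)
  have hz : ((cmLevelThree : ℍ) : ℂ) = ⟨1 / 2, √3 / 6⟩ := rfl
  rw [hz]
  apply Complex.ext <;> simp [sq] <;> nlinarith [h3]

/-- `i/√3` is a CM point of discriminant `-12` (root of `3z² + 1`). [folklore] -/
theorem isCMPointOfDisc_cmLevelThree' : IsCMPointOfDisc cmLevelThree' (-12) := by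
  refine ⟨3, 0, 1, by norm_num, by decide, ?_, by norm_num⟩
  have h3 : (√3 : ℝ) ^ 2 = 3 := Real.sq_sqrt (by norm_num)
  have hz : ((cmLevelThree' : ℍ) : ℂ) = ⟨0, 1 / √3⟩ := rfl
  rw [hz]
  apply Complex.ext
  · simp [sq]
    field_simp
    nlinarith [h3]
  · simp [sq]

/-- `|d|^{1/2} = √|d|`: the normalising factor at `k = 2`. [folklore] -/
theorem abs_rpow_two_sub_one_div_two (x : ℝ) :
    |x| ^ ((((2 : ℕ) : ℝ) - 1) / 2) = √|x| := by
  rw [Real.sqrt_eq_rpow]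
  norm_num

/-- **Level 1** (Zhou 2015, Remark 9, first display, in the normalisation of the conjecture):
`|(-3)(-4)|^{1/2} G₂^{Γ₀(1)}(ρ, i) = 2√3 · (-(24/√3) log(2+√3)) = -48 log(2+√3) = log (2+√3)^{-48}`.
[cite: Zhou2015, Remark 9 (arXiv p. 19)] -/
theorem higherGreenFunctionCM_level_one (h : Zhou2015_legendreP_sq_integral) :
    higherGreenFunctionCM 1 2 (-3) (-4) cmRho UpperHalfPlane.I = -48 * Real.log (2 + √3) := by
  rw [higherGreenFunctionCM, h.green_level_one, abs_rpow_two_sub_one_div_two]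
  have h12 : √|(((-3) * (-4) : ℤ) : ℝ)| = 2 * √3 := by
    rw [show |(((-3) * (-4) : ℤ) : ℝ)| = 2 ^ 2 * 3 by norm_num, Real.sqrt_mul (by norm_num),
      Real.sqrt_sq (by norm_num)]
  rw [h12]
  have h3 : (√3 : ℝ) ≠ 0 := by positivity
  field_simp
  ring

/-- **Level 2** (Zhou 2015, Remark 9, second display):
`|(-4)(-8)|^{1/2} G₂^{Γ₀(2)}((i-1)/2, i/√2) = 4√2 · (-(8/√2) log(1+√2)) = -32 log(1+√2)`.
[cite: Zhou2015, Remark 9 (arXiv p. 19)] -/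
theorem higherGreenFunctionCM_level_two (h : Zhou2015_legendreP_sq_integral) :
    higherGreenFunctionCM 2 2 (-4) (-8) cmLevelTwo cmLevelTwo' = -32 * Real.log (1 + √2) := by
  rw [higherGreenFunctionCM, h.green_level_two, abs_rpow_two_sub_one_div_two]
  have h32 : √|(((-4) * (-8) : ℤ) : ℝ)| = 4 * √2 := by
    rw [show |(((-4) * (-8) : ℤ) : ℝ)| = 4 ^ 2 * 2 by norm_num, Real.sqrt_mul (by norm_num),
      Real.sqrt_sq (by norm_num)]
  rw [h32]
  have h2 : (√2 : ℝ) ≠ 0 := by positivity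
  field_simp
  ring

/-- **Level 3** (Zhou 2015, Remark 9, third display):
`|(-3)(-12)|^{1/2} G₂^{Γ₀(3)}((3+i√3)/6, i/√3) = 6 · (-4 log 2) = -24 log 2 = log 2^{-24}`.
[cite: Zhou2015, Remark 9 (arXiv p. 19)] -/
theorem higherGreenFunctionCM_level_three (h : Zhou2015_legendreP_sq_integral) :
    higherGreenFunctionCM 3 2 (-3) (-12) cmLevelThree cmLevelThree' = -24 * Real.log 2 := by
  rw [higherGreenFunctionCM, h.green_level_three, abs_rpow_two_sub_one_div_two]
  have h36 : √|(((-3) * (-12) : ℤ) : ℝ)| = 6 := by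
    rw [show |(((-3) * (-12) : ℤ) : ℝ)| = 6 ^ 2 by norm_num, Real.sqrt_sq (by norm_num)]
  rw [h36]
  ring

/-! ## 2. The analytic characterisation of `G_k^{Γ₀(N)}` -/

/-- The hyperbolic Laplacian `D F = y² (∂²F/∂x² + ∂²F/∂y²)` of a real function on `ℍ` (sign of
Zhang 1997 p. 132 and Iwaniec (1.19), as the tree's complex-valued `hypLaplacian`): Mathlib's
Euclidean Laplacian of the extension `F ∘ ofComplex : ℂ → ℝ` (which agrees with `F` on the open set
`ℍ ⊆ ℂ`) at `z`, times `(Im z)²`. Meaningful where that extension is `C²`. [cite: Iwaniec2002, (1.19)] -/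
def realHypLaplacian (F : ℍ → ℝ) (z : ℍ) : ℝ :=
  z.im ^ 2 * (Δ (fun w : ℂ => F (ofComplex w))) (z : ℂ)

/-- **Properties (a), (c) of Gross–Zagier/Zhang for a function of one variable.** For a level `N`,
a weight parameter `k` and a base point `z' ∈ ℍ`, `IsResolventGreenLike N k z' F` says of `F : ℍ → ℝ`
(to be thought of as `z ↦ G(z, z')`): it is `Γ₀(N)`-invariant; off the orbit `Γ₀(N) z'` it is `C²`
and satisfies `(D - k(k-1)) F = 0`, `D = y²(∂²/∂x² + ∂²/∂y²)` (Zhang 1997 p. 132 (a); eigenvalue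
`s(1-s)`, `s = k`, for `-D` in Bruinier–Li–Yang 2025 p. 3); and at every cusp `σ∞`, `σ ∈ SL₂(ℤ)`,
`(Im z)^{k-1} F(σ z)` stays bounded as `Im z → ∞` (Zhang (c): "`Im(γz)^{k-1} G_k(z, z')` extends to a
continuous function" at the cusp; in particular `F → 0` at the cusps for `k ≥ 2`, Viazovska's (v)).
The values of `F` on the orbit itself are not constrained (there `G` is singular and the tree's
`higherGreen` takes an unspecified finite value). The exponent `k - 1` is natural subtraction
(meaningful for `k ≥ 1`; the facts below assume `k ≥ 2`). [cite: Zhang1997, §3.4 (properties (a), (c), p. 132)] -/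
structure IsResolventGreenLike (N k : ℕ) (z' : ℍ) (F : ℍ → ℝ) : Prop where
  /-- `Γ₀(N)`-invariance: `F(γz) = F(z)` for `γ ∈ Γ₀(N)`. -/
  smul_eq : ∀ γ : SL(2, ℤ), γ ∈ Gamma0 N → ∀ z : ℍ, F (γ • z) = F z
  /-- `F` is `C²` (as a function of `(x, y)`, through `ofComplex`) at every point of `ℍ` off the
  orbit `Γ₀(N) z'`. -/
  contDiffAt : ∀ z : ℍ, z ∉ MulAction.orbit (Gamma0 N) z' →
    ContDiffAt ℝ 2 (fun w : ℂ => F (ofComplex w)) (z : ℂ)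
  /-- (a) `y²(F_xx + F_yy) = k(k-1) F` off the orbit `Γ₀(N) z'`. -/
  laplacian_eq : ∀ z : ℍ, z ∉ MulAction.orbit (Gamma0 N) z' →
    realHypLaplacian F z = (k : ℝ) * ((k : ℝ) - 1) * F z
  /-- (c) at the cusp `σ∞`: `|F(σz)| (Im z)^{k-1} ≤ C` for `Im z ≥ B`. -/
  cusp_bound : ∀ σ : SL(2, ℤ), ∃ C B : ℝ, ∀ z : ℍ, B ≤ z.im → |F (σ • z)| * z.im ^ (k - 1) ≤ C

/-- The class `IsResolventGreenLike N k z'` is stable under real scalars (all conditions are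
linear). [folklore] -/
theorem IsResolventGreenLike.const_mul {N k : ℕ} {z' : ℍ} {F : ℍ → ℝ}
    (hF : IsResolventGreenLike N k z' F) (a : ℝ) :
    IsResolventGreenLike N k z' (fun z => a * F z) where
  smul_eq γ hγ z := by rw [hF.smul_eq γ hγ z]
  contDiffAt z hz := contDiffAt_const.mul (hF.contDiffAt z hz)
  laplacian_eq z hz := by
    have h2 := hF.contDiffAt z hz
    have hsmul : (fun w : ℂ => a * F (ofComplex w)) = a • (fun w : ℂ => F (ofComplex w)) := by
      ext w; simp
    unfold realHypLaplacian
    rw [hsmul, InnerProductSpace.laplacian_smul a h2, smul_eq_mul]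
    have := hF.laplacian_eq z hz
    unfold realHypLaplacian at this
    calc z.im ^ 2 * (a * Δ (fun w : ℂ => F (ofComplex w)) (z : ℂ))
        = a * (z.im ^ 2 * Δ (fun w : ℂ => F (ofComplex w)) (z : ℂ)) := by ring
      _ = a * ((k : ℝ) * ((k : ℝ) - 1) * F z) := by rw [this]
      _ = (k : ℝ) * ((k : ℝ) - 1) * (a * F z) := by ring
  cusp_bound σ := by
    obtain ⟨C, B, hCB⟩ := hF.cusp_bound σ
    refine ⟨|a| * C, B, fun z hz => ?_⟩
    have := hCB z hz
    rw [abs_mul, mul_assoc]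
    exact mul_le_mul_of_nonneg_left this (abs_nonneg a)

/-- **Uniqueness of the resolvent Green function with prescribed singularity** (named fact).
Gross–Zagier 1986 §II.2 / Zhang 1997 p. 132: "We claim that these properties characterize `G_k(z, z')`
uniquely. Indeed, if `G'_k(z, z')` is another function satisfying same properties, then for each `z'`
the difference `f(z) := G_k(z, z') - G'_k(z, z')` is a continuous function on `X` killed by
`D - k(k-1)` for all noncuspidal `z ≠ z'` […] `g - f` is continuous at `z'` and harmonic away from
`z'` […] so `f` is killed by `D - k(k-1)` at all points of `ℌ`. Since `D` is a negative operator on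
`L²(X)` it follows `f = 0`"; Bruinier–Li–Yang 2025 p. 3: "these properties characterize it uniquely",
and the same argument in their proof of Corollary 2.4 ("their difference is a smooth function in
`L²(X₀(N)²)` and an eigenfunction of the Laplacians […] which vanishes identically"). Lean form: for `N ≥ 1`, `k ≥ 2` and a base point `z'`, two functions with properties (a), (c) and
`Γ₀(N)`-invariance off `Γ₀(N)z'` (`IsResolventGreenLike`) whose difference is bounded on a punctured
neighbourhood of `z'` (same logarithmic singularity (b); by invariance the difference is then bounded
near every point of the orbit, and a bounded solution of the elliptic equation has removable
singularities) agree off the orbit. (`k ≥ 2` is needed: for `k = 1` constants satisfy (a), (c).)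
[cite: Zhang1997, §3.4 (uniqueness claim, p. 132)] [cite: BruinierLiYang2025, p. 3 and proof of Cor. 2.4] -/
def resolventGreen_unique : Prop :=
  ∀ (N k : ℕ), 0 < N → 2 ≤ k → ∀ (z' : ℍ) (F₁ F₂ : ℍ → ℝ),
    IsResolventGreenLike N k z' F₁ → IsResolventGreenLike N k z' F₂ →
    (∃ C ε : ℝ, 0 < ε ∧ ∀ z : ℍ, dist z z' < ε → z ∉ MulAction.orbit (Gamma0 N) z' →
      |F₁ z - F₂ z| ≤ C) →
    ∀ z : ℍ, z ∉ MulAction.orbit (Gamma0 N) z' → F₁ z = F₂ z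

/-- **`G_k^{Γ₀(N)}` has properties (a), (b), (c)** (named fact; Gross–Zagier 1986 §II.2 as recalled
by Zhang 1997 p. 132: "It has been shown in [GZ86], Chapter [II], that `G_k(z, z')` on `X` has the
following properties: (a) […] (b) `G_k(z, z') = log|z - z'|² + O(1)` as `z → z'` (c) […]", and
Bruinier–Li–Yang 2025 p. 3 for (1.1) itself). Lean form, for `N ≥ 1`, `k ≥ 2`, `z' ∈ ℍ` and the tree's
`higherGreen N k 1 = -2 Σ_{γ ∈ Γ₀(N)} Q_{k-1}(cosh d(z, γz'))`: `z ↦ G_k^{Γ₀(N)}(z, z')` is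
`IsResolventGreenLike N k z'`, and near `z'`
`G_k^{Γ₀(N)}(z, z') = n_{z'} · log|z - z'|² + O(1)` with `n_{z'} = #{γ ∈ Γ₀(N) : γz' = z'}` the order of
the stabiliser in `Γ₀(N) ≤ SL₂(ℤ)` (`= 2`, from `±1`, at a non-elliptic point — the printed `log|z-z'|²`
for the sum over `Γ₀(N)/±1`): each stabiliser element contributes one term
`-2Q_{k-1}(1 + |z-z'|²/(2yy')) = log|z - z'|² + O(1)` of the series (`Q_{k-1}(t) = -½ log(t-1) + O(1)`
as `t → 1⁺`), the remaining terms being smooth at `z'`. [cite: Zhang1997, §3.4 (properties (a)–(c) of G_k, p. 132)] -/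
def higherGreen_isResolventGreenLike : Prop :=
  ∀ (N k : ℕ), 0 < N → 2 ≤ k → ∀ z' : ℍ,
    IsResolventGreenLike N k z' (fun z => higherGreen N k 1 z z') ∧
    ∃ C ε : ℝ, 0 < ε ∧ ∀ z : ℍ, dist z z' < ε → z ≠ z' →
      |higherGreen N k 1 z z' -
        (Nat.card (MulAction.stabilizer (Gamma0 N) z') : ℝ) * Real.log (dist (z : ℂ) (z' : ℂ) ^ 2)| ≤ C

/-! ## 3. Zhang 1997: archimedean local heights of CM cycles -/

/-- **The archimedean local height pairing of CM cycles on the Kuga–Sato variety over `X₀(N)`,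
as an interface** (Zhang 1997, §3–4). For `k ≥ 2` and CM points `x ≠ y` of `X₀(N)`, Zhang defines CM
cycles `S_k(x)`, `S_k(y)` of codimension `k` on the Kuga–Sato variety `Y = Y_k` (the canonical
resolution of the `(2k-2)`-fold fibre product of the universal elliptic curve, §2; over `X₀(N)` by
pull-back to `X(N')`, §4.1), arithmetic cycles `Ŝ_k(x) = (S_k(x), g_k(x))` with the Green current
normalised by `∫ g_k(x) η = 0` for `∂∂̄`-closed `η` (p. 125), and the local height at a complex place
`⟨S_k(x), S_k(y)⟩_v := (-1)^k (Ŝ_k(x) · Ŝ_k(y))_v` ((3.2.2), §1.3.3), which equals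
`H_k(x, y) := (-1)^k ∫_{Y_y} g_y g_k(x)` ((3.4.3)–(3.4.4)), a function of all non-cuspidal `y ∉ Γ₀(N)x`
once the CM point `x` is fixed. None of this (currents, arithmetic Chow groups, the complex points
of `Y`) exists in Mathlib, so — as for the tree's `KugaSatoVariety` — the pairing is recorded by its
data and the properties Zhang PROVES for it (§3.4–3.5, p. 132: "to show the equality
`H_k = ½ G_k` it suffices to check that `H_k(z, z')` has corresponding properties. Notice that
Property (b) is already shown in the formulas in Sect. 1.4"; §3.5 "Continuity at cusps" is (c)):

* `pair x y = H_k(x, y)` (total function; meaningful for `x` CM, `y ∉ Γ₀(N)x`);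
* for every CM point `x` (of any discriminant), `y ↦ H_k(x, y)` is `Γ₀(N)`-invariant, `C²` with
  `(D - k(k-1)) H_k(x, ·) = 0` off `Γ₀(N)x` (a), and `O((Im)^{1-k})` at every cusp (c);
* (b): `H_k(x, y) - ½ G_k(x, y)` is bounded for `y` near `x` (`½ G_k` of Zhang = `¼ · higherGreen N k 1`).

A statement quantified over this structure is a statement about every pairing with these
properties; by `resolventGreen_unique` there is at most one (off the orbit), and Zhang 1997 shows the
Gillet–Soulé pairing is one. [cite: Zhang1997, §3.4–3.5 ((3.4.3)–(3.4.5), properties of H_k) and Prop. 4.1.2] -/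
structure Zhang1997.ArchCMHeightPairing (N k : ℕ) where
  /-- `pair x y = H_k(x, y) = ⟨S_k(x), S_k(y)⟩_∞` (Zhang (3.4.3)–(3.4.4)). -/
  pair : ℍ → ℍ → ℝ
  /-- For a CM point `x`, `y ↦ H_k(x, y)` has properties (a), (c) and is `Γ₀(N)`-invariant
  (Zhang 1997 §3.4 (a), §3.5 (c); invariance: it is a function on `X₀(N)`). -/
  isResolventGreenLike : ∀ (x : ℍ) (d : ℤ), IsCMPointOfDisc x d →
    IsResolventGreenLike N k x (pair x)
  /-- (b): `H_k(x, y) - ½ G_k(x, y) = O(1)` for `y → x` (Zhang 1997 §1.4 and (3.4.5);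
  `½ G_k = ¼ · higherGreen N k 1` in the tree's normalisation). -/
  sub_bounded : ∀ (x : ℍ) (d : ℤ), IsCMPointOfDisc x d →
    ∃ C ε : ℝ, 0 < ε ∧ ∀ y : ℍ, dist y x < ε → y ∉ MulAction.orbit (Gamma0 N) x →
      |pair x y - 1 / 4 * higherGreen N k 1 x y| ≤ C

/-- **Zhang 1997, Proposition 4.1.2 (and 3.4.1): the archimedean local height of CM cycles is the
higher Green function.** "For two CM-points `x` and `y` on `X`, one has
`⟨S_k(x), S_k(y)⟩ = ½ G_k(x, y)` if `x ≠ y`" (Prop. 3.4.1 for `X = X(N)`, Prop. 4.1.2 for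
`X = X₀(N)`), where `G_k(z, z') = Σ_{γ ∈ Γ} g_k(z, γz')`, `g_k(z, z') = -2Q_{k-1}(1 + |z - z'|²/(2 Im z Im z'))`
(§3.4; `Γ = Γ₀(N)/±1`, so `½ G_k = ¼ · higherGreen N k 1`). Here, for any pairing with the
properties Zhang establishes (`Zhang1997.ArchCMHeightPairing`), a CM point `x` and ANY `y ∉ Γ₀(N)x`
(Zhang's `H_k(x, ·)` is defined for all non-cuspidal `y`; (3.4.4) identifies it with the height for
CM `y`), conditionally on the two analytic named facts above — which is exactly Zhang's proof
(p. 132). [cite: Zhang1997, Prop. 4.1.2 (and Prop. 3.4.1, §3.4)] -/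
theorem zhang_heegnerCycles_height (hU : resolventGreen_unique)
    (hE : higherGreen_isResolventGreenLike) {N k : ℕ} (hN : 0 < N) (hk : 2 ≤ k)
    (H : Zhang1997.ArchCMHeightPairing N k) {x : ℍ} {d : ℤ} (hx : IsCMPointOfDisc x d) {y : ℍ}
    (hy : y ∉ MulAction.orbit (Gamma0 N) x) :
    H.pair x y = 1 / 4 * higherGreen N k 1 x y := by
  -- `F₂ := ¼ G_k(·, x) = ¼ G_k(x, ·)` has properties (a), (c) by `hE`, symmetry and linearity
  have hsymm : (fun z => 1 / 4 * higherGreen N k 1 x z) = fun z => 1 / 4 * higherGreen N k 1 z x := by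
    funext z; rw [higherGreen_symm one_pos k x z]
  have hF₂ : IsResolventGreenLike N k x (fun z => 1 / 4 * higherGreen N k 1 x z) := by
    rw [hsymm]
    exact (hE N k hN hk x).1.const_mul (1 / 4)
  exact hU N k hN hk x (H.pair x) (fun z => 1 / 4 * higherGreen N k 1 x z)
    (H.isResolventGreenLike x d hx) hF₂ (H.sub_bounded x d hx) y hy


/-! ## 4. Proof of `resolventGreen_unique` (Zhang 1997, p. 132) by the maximum principle

Zhang 1997, p. 132: "We claim that these properties characterize `G_k(z, z')` uniquely. Indeed, if
`G'_k(z, z')` is another function satisfying same properties, then for each `z'` the difference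
`f(z) := G_k(z, z') - G'_k(z, z')` is a continuous function on `X` killed by `D - k(k-1)` for all
noncuspidal `z ≠ z'` […] So `f` is killed by `D - k(k-1)` at all points of `ℋ`. Since `D` is a
negative operator on `L²(X)` it follows `f = 0`."

### The argument

Zhang's printed proof (p. 132) has two steps: (1) the difference `f = F₁ - F₂`, bounded near `z'`
and killed by `D - k(k-1)` away from the orbit, extends across the orbit points ("by a standard
fact of harmonic functions", after subtracting a local solution `g` of `Dg = k(k-1)f`); (2) "Since
`D` is a negative operator on `L²(X)` it follows `f = 0`". Mathlib has neither the local
solvability of `Dg = h` / the removable-singularity theorem nor the spectral theory of `D` on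
`L²(X₀(N))`, so both steps are replaced here by their classical maximum-principle form, which
proves exactly the same statement:

* **(2') weak maximum principle.** At an interior local maximum of a `C²` function the Euclidean
  Laplacian is `≤ 0` (second-order necessary condition, `laplacian_nonpos_of_isLocalMax`, from
  `Literature.Analysis.PDE.fderiv_fderiv_nonneg_of_isLocalMin`); hence a solution of
  `y² Δf = λ f`, `λ = k(k-1) > 0`, has no positive interior local maximum. This is the pointwise
  content of the negativity of `D - k(k-1)` (Gilbarg–Trudinger, Cor. 3.2 with `c = -λ/y² < 0`).
* **(1') bounded singularities are removable for the maximum principle** (`le_of_forall_sphere_le`):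
  if `y² Δf = λ f` on a punctured hyperbolic disc around `p`, `f` is bounded above there and
  `f ≤ M` (`M ≥ 0`) on the boundary circle, then `f ≤ M` inside — compare `f` with
  `f + ε (log |w - p| - log D)`, which is `-∞` at `p`, still a subsolution (`log |w - p|` is harmonic,
  Mathlib `AnalyticAt.harmonicAt_log_norm`), and let `ε → 0` (the classical Bôcher-type barrier
  argument; e.g. Axler–Bourdon–Ramey, *Harmonic Function Theory*, Thm. 2.3 for harmonic `f`).
* **compactness of `X₀(N)` away from the cusps** (`exists_isCompact_of_cusp_decay`): by the cusp
  condition (c) with `k ≥ 2`, `|f| ≤ η` outside the `Γ₀(N)`-translates of a compact set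
  `K = ⋃_{g ∈ R} g 𝒟_B` (`R` inverses of coset representatives of `Γ₀(N)` in `SL₂(ℤ)`, Mathlib
  `CongruenceSubgroup.instFiniteIndexGamma0`, `ModularGroup.exists_smul_mem_fd`,
  `ModularGroup.isCompact_truncatedFundamentalDomain`; Diamond–Shurman Lemma 2.3.1 / §2.4), and
  the orbit `Γ₀(N)z'` meets a compact set in finitely many points (proper discontinuity of
  `SL₂(ℤ)` on `ℍ`, Mathlib `properlyDiscontinuousSL2ZRange`).

Given these, if `f(z₀) > 0` at some `z₀ ∉ Γ₀(N)z'`, then `f` restricted to the compact set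
`K₁ \ ⋃_{p} B(p, r)` (`K₁` the closed `1`-thickening of `K`, `p` over the finitely many orbit points
in `K₁`, `r` small) attains a maximum `M > 0` at some `z₁` off the orbit, and by (1') and
`Γ₀(N)`-invariance `M` is the maximum of `f` over all of `ℍ \ Γ₀(N)z'`, contradicting (2').
Applied to `F₁ - F₂` and `F₂ - F₁` this gives `F₁ = F₂` off the orbit.
-/

section ResolventGreenUniqueProof

open Set Metric InnerProductSpace
open scoped Modular

namespace ResolventGreenUnique

/-! ### 1. The Euclidean Laplacian at a local maximum -/

/-- **Second-order necessary condition, Laplacian form.** At a local maximum of a real function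
on `ℂ` which is `C²` there, the Euclidean Laplacian `∂ₓ²u + ∂ᵧ²u` is `≤ 0` (each pure second
derivative is `≤ 0`). [folklore] -/
theorem laplacian_nonpos_of_isLocalMax {u : ℂ → ℝ} {x : ℂ} (hmax : IsLocalMax u x)
    (hu : ContDiffAt ℝ 2 u x) : Δ u x ≤ 0 := by
  have hmin : IsLocalMin (fun y => -u y) x := hmax.neg
  have hneg : ∀ v : ℂ, fderiv ℝ (fderiv ℝ (fun y => -u y)) x v v
      = -(fderiv ℝ (fderiv ℝ u) x v v) := by
    intro v
    have h1 : fderiv ℝ (fun y => -u y) = fun y => -fderiv ℝ u y := by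
      funext y
      exact fderiv_fun_neg
    rw [h1, fderiv_fun_neg]
    rfl
  have key : ∀ v : ℂ, fderiv ℝ (fderiv ℝ u) x v v ≤ 0 := fun v => by
    have := Literature.Analysis.PDE.fderiv_fderiv_nonneg_of_isLocalMin hmin hu.neg v
    rw [hneg] at this
    linarith
  rw [laplacian_eq_iteratedFDeriv_complexPlane]
  simp only [iteratedFDeriv_two_apply, Matrix.cons_val_zero, Matrix.cons_val_one]
  linarith [key 1, key Complex.I]

/-- `ofComplex : ℂ → ℍ` is continuous at the points of the upper half-plane. [folklore] -/
theorem continuousAt_ofComplex {z : ℂ} (hz : 0 < z.im) : ContinuousAt ofComplex z :=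
  (mdifferentiableAt_ofComplex hz).continuousAt

/-- A function `f : ℍ → ℝ` whose extension `f ∘ ofComplex` is `Cⁿ` at `z` is continuous at `z`.
[folklore] -/
theorem continuousAt_of_contDiffAt_comp_ofComplex {f : ℍ → ℝ} {z : ℍ} {n : WithTop ℕ∞}
    (h : ContDiffAt ℝ n (fun v : ℂ => f (ofComplex v)) (z : ℂ)) : ContinuousAt f z := by
  have h2 : ContinuousAt (fun w : ℍ => (fun v : ℂ => f (ofComplex v)) (w : ℂ)) z :=
    h.continuousAt.comp continuous_coe.continuousAt
  simpa only [ofComplex_apply] using h2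

/-- A local maximum of `f : ℍ → ℝ` at `z ∈ ℍ` is a local maximum of `f ∘ ofComplex : ℂ → ℝ` at
`z`. [folklore] -/
theorem isLocalMax_comp_ofComplex {f : ℍ → ℝ} {z : ℍ} (h : IsLocalMax f z) :
    IsLocalMax (fun v : ℂ => f (ofComplex v)) (z : ℂ) := by
  have : IsLocalMax f (ofComplex (z : ℂ)) := by rwa [ofComplex_apply]
  exact this.comp_continuous (continuousAt_ofComplex z.im_pos)

/-! ### 2. Orbits of subgroups of `SL(2, ℤ)` in `ℍ` are discrete and closed -/

/-- The Möbius action of a fixed `g ∈ SL(2, ℤ)` on `ℍ` is continuous. [folklore] -/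
theorem continuous_sl_smul (g : SL(2, ℤ)) : Continuous fun τ : ℍ => g • τ := by
  change Continuous fun τ : ℍ => (Matrix.SpecialLinearGroup.mapGL ℝ g : GL (Fin 2) ℝ) • τ
  exact continuous_const_smul _

/-- **Proper discontinuity of `SL(2, ℤ)` on `ℍ`** (Mathlib, for the image `𝒮ℒ ≤ GL(2, ℝ)`): only
finitely many `g ∈ SL(2, ℤ)` move a given point into a given compact set.
[cite: DiamondShurman2005, Prop. 2.1.1 (proof)] -/
theorem finite_setOf_smul_mem (z' : ℍ) {L : Set ℍ} (hL : IsCompact L) :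
    {g : SL(2, ℤ) | g • z' ∈ L}.Finite := by
  have h : {γ : 𝒮ℒ | ((γ • ·) '' {z'} ∩ L).Nonempty}.Finite :=
    ProperlyDiscontinuousSMul.finite_disjoint_inter_image isCompact_singleton hL
  refine (h.preimage (f := fun γ : SL(2, ℤ) =>
      (⟨Matrix.SpecialLinearGroup.mapGL ℝ γ, γ, rfl⟩ : 𝒮ℒ)) ?_).subset fun γ hγ => ?_
  · exact fun a _ b _ hab => Matrix.SpecialLinearGroup.mapGL_injective (congrArg Subtype.val hab)
  · simp only [Set.mem_preimage, Set.mem_setOf_eq, Set.image_singleton,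
      Set.singleton_inter_nonempty]
    exact hγ

/-- **Orbits are locally a single point**: every `x ∈ ℍ` has a neighbourhood meeting the orbit
`Γ z'` of a subgroup `Γ ≤ SL(2, ℤ)` at most in `x` itself. [cite: DiamondShurman2005, Prop. 2.1.1] -/
theorem exists_nhds_forall_mem_orbit_eq (Γ : Subgroup SL(2, ℤ)) (z' x : ℍ) :
    ∃ V ∈ 𝓝 x, ∀ y ∈ V, y ∈ MulAction.orbit Γ z' → y = x := by
  obtain ⟨L, hL, hxL⟩ := exists_compact_mem_nhds x
  have hfin := finite_setOf_smul_mem z' hL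
  set B : Set ℍ := (fun g : SL(2, ℤ) => g • z') '' {g : SL(2, ℤ) | g • z' ∈ L ∧ g • z' ≠ x}
    with hB
  have hBfin : B.Finite := (hfin.subset fun g hg => hg.1).image _
  have hxB : x ∉ B := by
    rintro ⟨g, hg, hgx⟩
    exact hg.2 hgx
  refine ⟨L ∩ Bᶜ, inter_mem hxL (hBfin.isClosed.isOpen_compl.mem_nhds hxB), ?_⟩
  rintro y ⟨hyL, hyB⟩ hy
  obtain ⟨γ, rfl⟩ := MulAction.mem_orbit_iff.mp hy
  by_contra hne
  exact hyB ⟨(γ : SL(2, ℤ)), ⟨hyL, hne⟩, rfl⟩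

/-- The complement of an orbit `Γ z'` (`Γ ≤ SL(2, ℤ)`) is open in `ℍ`. [folklore] -/
theorem isOpen_compl_orbit (Γ : Subgroup SL(2, ℤ)) (z' : ℍ) :
    IsOpen (MulAction.orbit Γ z')ᶜ := by
  rw [isOpen_iff_mem_nhds]
  intro x hx
  obtain ⟨V, hV, hV'⟩ := exists_nhds_forall_mem_orbit_eq Γ z' x
  filter_upwards [hV] with y hy hy'
  exact hx (hV' y hy hy' ▸ hy')

/-- An orbit `Γ z'` (`Γ ≤ SL(2, ℤ)`) meets every compact subset of `ℍ` in a finite set.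
[cite: DiamondShurman2005, Prop. 2.1.1] -/
theorem finite_orbit_inter (Γ : Subgroup SL(2, ℤ)) (z' : ℍ) {K : Set ℍ} (hK : IsCompact K) :
    (MulAction.orbit Γ z' ∩ K).Finite := by
  have h : ∀ x ∈ K, ∃ V ∈ 𝓝 x, ∀ y ∈ V, y ∈ MulAction.orbit Γ z' → y = x :=
    fun x _ => exists_nhds_forall_mem_orbit_eq Γ z' x
  choose! V hV hV' using h
  obtain ⟨t, htK, hKt⟩ := hK.elim_nhds_subcover V fun x hx => hV x hx
  refine t.finite_toSet.subset ?_
  rintro y ⟨hyA, hyK⟩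
  obtain ⟨x, hxt, hyx⟩ := Set.mem_iUnion₂.mp (hKt hyK)
  have : y = x := hV' x (htK x hxt) y hyx hyA
  rw [this]
  exact hxt

/-! ### 3. Reduction theory: `X₀(N)` is compact away from the cusps -/

/-- **`ℍ = Γ · R · 𝒟` for a finite set `R`** when `Γ ≤ SL(2, ℤ)` has finite index (`R` = inverses
of representatives of `SL(2, ℤ)/Γ`; Mathlib `ModularGroup.exists_smul_mem_fd`).
[cite: DiamondShurman2005, Lemma 2.3.1 and Prop. 2.4.2 (proof)] -/
theorem exists_finset_cover (Γ : Subgroup SL(2, ℤ)) [Γ.FiniteIndex] :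
    ∃ R : Finset SL(2, ℤ), ∀ τ : ℍ, ∃ γ ∈ Γ, ∃ g ∈ R, ∃ z ∈ 𝒟, τ = γ • g • z := by
  classical
  haveI : Fintype (SL(2, ℤ) ⧸ Γ) := Subgroup.fintypeQuotientOfFiniteIndex
  refine ⟨Finset.univ.image fun q : SL(2, ℤ) ⧸ Γ => (Quotient.out q)⁻¹, fun τ => ?_⟩
  obtain ⟨g₀, hg₀⟩ := ModularGroup.exists_smul_mem_fd τ
  set r : SL(2, ℤ) := Quotient.out (g₀ : SL(2, ℤ) ⧸ Γ) with hr
  have hrg : r⁻¹ * g₀ ∈ Γ := by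
    rw [← QuotientGroup.eq, hr, QuotientGroup.out_eq']
  refine ⟨(r⁻¹ * g₀)⁻¹, inv_mem hrg, r⁻¹, Finset.mem_image.mpr ⟨(g₀ : SL(2, ℤ) ⧸ Γ),
    Finset.mem_univ _, rfl⟩, g₀ • τ, hg₀, ?_⟩
  simp only [smul_smul, mul_inv_rev, inv_inv]
  rw [show g₀⁻¹ * r * (r⁻¹ * g₀) = 1 by group, one_smul]

/-- **Compactness of `X₀(N)` away from the cusps.** If `f : ℍ → ℝ` is `Γ₀(N)`-invariant and small
high in every cusp (`|f(σz)| ≤ η` for `Im z` large, for each `σ ∈ SL(2, ℤ)`), then there is a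
compact `K ⊆ ℍ` such that every point of `ℍ` is either `Γ₀(N)`-equivalent to a point of `K` or a
point where `|f| ≤ η` (`K = ⋃_{g ∈ R} g 𝒟_B`, Mathlib
`ModularGroup.isCompact_truncatedFundamentalDomain`). [cite: DiamondShurman2005, §2.4] -/
theorem exists_isCompact_of_cusp_decay {N : ℕ} [NeZero N] {f : ℍ → ℝ}
    (hinv : ∀ γ ∈ Gamma0 N, ∀ z : ℍ, f (γ • z) = f z)
    (hcusp : ∀ σ : SL(2, ℤ), ∀ η : ℝ, 0 < η → ∃ B : ℝ, ∀ z : ℍ, B ≤ z.im → |f (σ • z)| ≤ η)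
    {η : ℝ} (hη : 0 < η) :
    ∃ K : Set ℍ, IsCompact K ∧
      ∀ τ : ℍ, (∃ γ ∈ Gamma0 N, ∃ w ∈ K, τ = γ • w) ∨ |f τ| ≤ η := by
  classical
  obtain ⟨R, hR⟩ := exists_finset_cover (Gamma0 N)
  choose B hB using fun σ : SL(2, ℤ) => hcusp σ η hη
  set B₀ : ℝ := ∑ g ∈ R, |B g| with hB₀
  have hB₀ge : ∀ g ∈ R, B g ≤ B₀ := fun g hg =>
    (le_abs_self _).trans
      (Finset.single_le_sum (f := fun g => |B g|) (fun _ _ => abs_nonneg _) hg)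
  refine ⟨⋃ g ∈ R, (fun z : ℍ => g • z) '' ModularGroup.truncatedFundamentalDomain B₀, ?_, ?_⟩
  · exact R.isCompact_biUnion fun g _ =>
      (ModularGroup.isCompact_truncatedFundamentalDomain B₀).image (continuous_sl_smul g)
  · intro τ
    obtain ⟨γ, hγ, g, hg, z, hz, rfl⟩ := hR τ
    rcases le_or_gt z.im B₀ with h | h
    · left
      exact ⟨γ, hγ, g • z, Set.mem_biUnion hg ⟨z, ⟨hz, h⟩, rfl⟩, rfl⟩
    · right
      rw [hinv γ hγ]
      exact hB g z ((hB₀ge g hg).trans h.le)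

/-- Hyperbolic spheres in `ℍ` are nonempty: the point above `q` at hyperbolic distance `r`.
[folklore] -/
theorem exists_dist_eq (q : ℍ) {r : ℝ} (hr : 0 ≤ r) : ∃ y : ℍ, dist y q = r := by
  refine ⟨UpperHalfPlane.mk ⟨q.re, Real.exp r * q.im⟩ (by positivity), ?_⟩
  rw [UpperHalfPlane.dist_of_re_eq]
  · change dist (Real.log (Real.exp r * q.im)) (Real.log q.im) = r
    rw [Real.log_mul (Real.exp_pos r).ne' q.im_pos.ne', Real.log_exp, Real.dist_eq]
    simp [abs_of_nonneg hr]
  · rfl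

/-! ### 4. Bounded singularities and the maximum principle -/

/-- **A bounded isolated singularity is invisible to the maximum principle** (the `ε log` barrier).
Let `f : ℍ → ℝ` be `C²` on the punctured closed hyperbolic disc `0 < ρ(w, p) ≤ r` with
`Δₑf = c f`, `c > 0` (`Δₑ` the Euclidean Laplacian of `f ∘ ofComplex`), bounded above there, and
`f ≤ M` on the circle `ρ(w, p) = r` for some `M ≥ 0`. Then `f ≤ M` on the punctured open disc:
the function `f + ε (log |w - p| - log D)` (`D` the Euclidean radius of the disc) is `< M` near `p`,
`≤ M` on the outer circle, and has no interior maximum `> M ≥ 0` since there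
`Δₑ(f + ε log |· - p|) = c f > 0`; let `ε → 0`. [folklore] -/
theorem le_of_forall_sphere_le {f : ℍ → ℝ} {c : ℍ → ℝ} {p : ℍ} {r C M : ℝ} (hr : 0 < r)
    (hM : 0 ≤ M)
    (hf : ∀ w : ℍ, 0 < dist w p → dist w p ≤ r →
      ContDiffAt ℝ 2 (fun v : ℂ => f (ofComplex v)) (w : ℂ) ∧
        Δ (fun v : ℂ => f (ofComplex v)) (w : ℂ) = c w * f w ∧ 0 < c w)
    (hC : ∀ w : ℍ, 0 < dist w p → dist w p ≤ r → f w ≤ C)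
    (hS : ∀ w : ℍ, dist w p = r → f w ≤ M) :
    ∀ w : ℍ, 0 < dist w p → dist w p < r → f w ≤ M := by
  intro w₀ hw₀ hw₀r
  by_contra hlt
  push Not at hlt
  -- the Euclidean size of the hyperbolic disc
  set D : ℝ := p.im * (Real.exp r - 1) with hD
  have hD0 : 0 < D := mul_pos p.im_pos (sub_pos.2 (Real.one_lt_exp_iff.2 hr))
  have hnormD : ∀ w : ℍ, dist w p ≤ r → ‖(w : ℂ) - p‖ ≤ D := fun w hw => by
    rw [← dist_eq_norm]
    refine (dist_coe_le w p).trans ?_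
    exact mul_le_mul_of_nonneg_left (sub_le_sub_right (Real.exp_le_exp.2 hw) _) p.im_pos.le
  have hnorm0 : ∀ w : ℍ, 0 < dist w p → 0 < ‖(w : ℂ) - p‖ := fun w hw => by
    rw [norm_pos_iff, sub_ne_zero]
    intro h
    exact (dist_pos.1 hw) (UpperHalfPlane.ext h)
  -- the barrier `h(w) = log |w - p| - log D ≤ 0`
  set h : ℍ → ℝ := fun w => Real.log ‖(w : ℂ) - p‖ - Real.log D with hh
  have hh_nonpos : ∀ w : ℍ, 0 < dist w p → dist w p ≤ r → h w ≤ 0 := fun w hw hwr => by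
    have := Real.log_le_log (hnorm0 w hw) (hnormD w hwr)
    simp only [hh]
    linarith
  -- the size `ε` of the perturbation: `f w₀ + ε h w₀ > M`
  have hh0 : h w₀ ≤ 0 := hh_nonpos w₀ hw₀ hw₀r.le
  set ε : ℝ := (f w₀ - M) / (2 * (1 - h w₀)) with hε
  have hε0 : 0 < ε := div_pos (by linarith) (by linarith)
  have hεh : ε * (1 - h w₀) = (f w₀ - M) / 2 := by
    have h1 : (1 - h w₀) ≠ 0 := (by linarith : (0 : ℝ) < 1 - h w₀).ne'
    rw [hε]
    field_simp
  have hu0 : M < f w₀ + ε * h w₀ := by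
    rw [mul_sub, mul_one] at hεh
    linarith
  -- the inner radius `δ`: on the circle `ρ = δ` the perturbed function is `< M`
  obtain ⟨δ, hδ0, hδw₀, hδC⟩ : ∃ δ : ℝ, 0 < δ ∧ δ < dist w₀ p ∧
      C + ε * (Real.log (p.im * (Real.exp δ - 1)) - Real.log D) < M := by
    set t₀ : ℝ := Real.exp ((M - C) / ε + Real.log D - 1) with ht₀
    have ht₀pos : 0 < t₀ := Real.exp_pos _
    have hcts : Continuous fun δ : ℝ => p.im * (Real.exp δ - 1) := by fun_prop
    have h1 : ∀ᶠ δ in 𝓝 (0 : ℝ), p.im * (Real.exp δ - 1) < t₀ := by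
      have hc := hcts.continuousAt (x := 0)
      have h0 : p.im * (Real.exp 0 - 1) = 0 := by simp
      rw [ContinuousAt, h0] at hc
      exact hc (Iio_mem_nhds ht₀pos)
    have h2 : ∀ᶠ δ in 𝓝[>] (0 : ℝ), 0 < δ ∧ δ < dist w₀ p := Ioo_mem_nhdsGT hw₀
    obtain ⟨δ, ⟨hδ0, hδw₀⟩, hδt⟩ := (h2.and (h1.filter_mono nhdsWithin_le_nhds)).exists
    refine ⟨δ, hδ0, hδw₀, ?_⟩
    have hpos : 0 < p.im * (Real.exp δ - 1) :=
      mul_pos p.im_pos (sub_pos.2 (Real.one_lt_exp_iff.2 hδ0))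
    have hlog : Real.log (p.im * (Real.exp δ - 1)) < (M - C) / ε + Real.log D - 1 := by
      have := Real.log_lt_log hpos hδt
      rwa [ht₀, Real.log_exp] at this
    have h3 : Real.log (p.im * (Real.exp δ - 1)) - Real.log D < (M - C) / ε := by linarith
    have h4 : ε * (Real.log (p.im * (Real.exp δ - 1)) - Real.log D) < M - C := by
      calc ε * (Real.log (p.im * (Real.exp δ - 1)) - Real.log D) < ε * ((M - C) / ε) :=
            mul_lt_mul_of_pos_left h3 hε0
        _ = M - C := by field_simp
    linarith
  -- the closed annulus `A = {δ ≤ ρ(w, p) ≤ r}` is compact and contains `w₀`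
  set A : Set ℍ := {w | δ ≤ dist w p ∧ dist w p ≤ r} with hA
  have hdist : Continuous fun w : ℍ => dist w p := continuous_id.dist continuous_const
  have hAc : IsCompact A :=
    (isCompact_closedBall p r).of_isClosed_subset
      ((isClosed_le continuous_const hdist).inter (isClosed_le hdist continuous_const))
      fun w hw => mem_closedBall.2 hw.2
  have hw₀A : w₀ ∈ A := ⟨hδw₀.le, hw₀r.le⟩
  -- the perturbed function `u = f + ε h` is continuous on `A`
  set u : ℍ → ℝ := fun w => f w + ε * h w with hu
  have hfcont : ∀ w : ℍ, 0 < dist w p → dist w p ≤ r → ContinuousAt f w := fun w hw hwr =>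
    continuousAt_of_contDiffAt_comp_ofComplex (hf w hw hwr).1
  have hhcont : ∀ w : ℍ, 0 < dist w p → ContinuousAt h w := fun w hw => by
    simp only [hh]
    refine ContinuousAt.sub ?_ continuousAt_const
    have h1 : ContinuousAt (fun w : ℍ => ‖(w : ℂ) - p‖) w :=
      ((continuous_coe.sub continuous_const).norm).continuousAt
    exact h1.log (hnorm0 w hw).ne'
  have hucont : ContinuousOn u A := fun w hw =>
    ((hfcont w (hδ0.trans_le hw.1) hw.2).add
      (continuousAt_const.mul (hhcont w (hδ0.trans_le hw.1)))).continuousWithinAt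
  -- its maximum over `A` is attained at some `w₁`, and exceeds `M`
  obtain ⟨w₁, hw₁A, hmax⟩ := hAc.exists_isMaxOn ⟨w₀, hw₀A⟩ hucont
  have hu1 : M < u w₁ := hu0.trans_le (hmax hw₀A)
  have hp1 : 0 < dist w₁ p := hδ0.trans_le hw₁A.1
  -- `w₁` is not on the outer circle (`u ≤ f ≤ M` there) ...
  have hout : dist w₁ p < r := by
    rcases hw₁A.2.lt_or_eq with hlt' | heq
    · exact hlt'
    · exfalso
      have h1 := hS w₁ heq
      have h2 : ε * h w₁ ≤ 0 :=
        mul_nonpos_of_nonneg_of_nonpos hε0.le (hh_nonpos w₁ hp1 hw₁A.2)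
      have : u w₁ ≤ M := by
        simp only [hu]
        linarith
      linarith
  -- ... nor on the inner circle (`u ≤ C + ε (log (Im p (e^δ - 1)) - log D) < M` there)
  have hin : δ < dist w₁ p := by
    rcases hw₁A.1.lt_or_eq with hlt' | heq
    · exact hlt'
    · exfalso
      have h1 := hC w₁ hp1 hw₁A.2
      have hn : ‖(w₁ : ℂ) - p‖ ≤ p.im * (Real.exp δ - 1) := by
        rw [← dist_eq_norm, heq]
        exact dist_coe_le w₁ p
      have hlog : Real.log ‖(w₁ : ℂ) - p‖ ≤ Real.log (p.im * (Real.exp δ - 1)) :=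
        Real.log_le_log (hnorm0 w₁ hp1) hn
      have h3 := mul_le_mul_of_nonneg_left (sub_le_sub_right hlog (Real.log D)) hε0.le
      have : u w₁ < M := by
        simp only [hu, hh]
        linarith
      linarith
  -- hence `w₁` is an interior local maximum of `u`
  have hlocal : IsLocalMax u w₁ := by
    have hopen : IsOpen {w : ℍ | δ < dist w p ∧ dist w p < r} :=
      (isOpen_lt continuous_const hdist).inter (isOpen_lt hdist continuous_const)
    filter_upwards [hopen.mem_nhds ⟨hin, hout⟩] with w hw
    exact hmax ⟨hw.1.le, hw.2.le⟩
  -- pass to `ℂ`: near `w₁`, `u ∘ ofComplex = f ∘ ofComplex + ε (log |· - p| - log D)`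
  set fC : ℂ → ℝ := fun v => f (ofComplex v) with hfC
  set uC : ℂ → ℝ := fun v => u (ofComplex v) with huC
  have hlocalC : IsLocalMax uC (w₁ : ℂ) := isLocalMax_comp_ofComplex hlocal
  have hev : uC =ᶠ[𝓝 (w₁ : ℂ)]
      fun v => fC v + ε * (Real.log ‖v - (p : ℂ)‖ - Real.log D) := by
    filter_upwards [eventuallyEq_coe_comp_ofComplex w₁.im_pos] with v hv
    simp only [Function.comp_apply, id_eq] at hv
    simp only [huC, hu, hh, hfC, hv]
  have hne : (w₁ : ℂ) - p ≠ 0 := norm_pos_iff.1 (hnorm0 w₁ hp1)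
  have han : AnalyticAt ℂ (fun v : ℂ => v - (p : ℂ)) (w₁ : ℂ) := analyticAt_id.sub analyticAt_const
  have hharm : HarmonicAt (fun v : ℂ => Real.log ‖v - (p : ℂ)‖) (w₁ : ℂ) :=
    han.harmonicAt_log_norm hne
  have hlogC : ContDiffAt ℝ 2 (fun v : ℂ => Real.log ‖v - (p : ℂ)‖) (w₁ : ℂ) := hharm.1
  have hΔlog : Δ (fun v : ℂ => Real.log ‖v - (p : ℂ)‖) (w₁ : ℂ) = 0 := by
    have := hharm.2.self_of_nhds
    simpa using this
  have hfC2 : ContDiffAt ℝ 2 fC (w₁ : ℂ) := (hf w₁ hp1 hout.le).1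
  have hgC2 : ContDiffAt ℝ 2 (fun v : ℂ => ε * (Real.log ‖v - (p : ℂ)‖ - Real.log D)) (w₁ : ℂ) :=
    contDiffAt_const.mul (hlogC.sub contDiffAt_const)
  have huC2 : ContDiffAt ℝ 2 uC (w₁ : ℂ) := (hfC2.add hgC2).congr_of_eventuallyEq hev
  -- the Laplacian of `u ∘ ofComplex` at `w₁` is `c(w₁) f(w₁) > 0` ...
  have hΔg : Δ (fun v : ℂ => ε * (Real.log ‖v - (p : ℂ)‖ - Real.log D)) (w₁ : ℂ) = 0 := by
    have e2 : (fun v : ℂ => ε * (Real.log ‖v - (p : ℂ)‖ - Real.log D)) =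
        ε • ((fun v : ℂ => Real.log ‖v - (p : ℂ)‖) - fun _ : ℂ => Real.log D) := by
      funext v
      simp [smul_eq_mul]
    have hsub : ContDiffAt ℝ 2 ((fun v : ℂ => Real.log ‖v - (p : ℂ)‖) - fun _ : ℂ => Real.log D)
        (w₁ : ℂ) := hlogC.sub contDiffAt_const
    rw [e2, laplacian_smul ε hsub, hlogC.laplacian_sub contDiffAt_const, hΔlog, laplacian_const]
    simp
  have hΔu : Δ uC (w₁ : ℂ) = c w₁ * f w₁ := by
    rw [(laplacian_congr_nhds hev).self_of_nhds]
    have e1 : (fun v => fC v + ε * (Real.log ‖v - (p : ℂ)‖ - Real.log D)) =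
        fC + fun v => ε * (Real.log ‖v - (p : ℂ)‖ - Real.log D) := rfl
    rw [e1, hfC2.laplacian_add hgC2, hΔg, add_zero]
    exact (hf w₁ hp1 hout.le).2.1
  -- ... while `f(w₁) ≥ u(w₁) > M ≥ 0`: contradiction with the maximum principle
  have hfw₁ : 0 < f w₁ := by
    have h2 : ε * h w₁ ≤ 0 :=
      mul_nonpos_of_nonneg_of_nonpos hε0.le (hh_nonpos w₁ hp1 hout.le)
    have : u w₁ = f w₁ + ε * h w₁ := rfl
    linarith
  have hpos : 0 < Δ uC (w₁ : ℂ) := by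
    rw [hΔu]
    exact mul_pos (hf w₁ hp1 hout.le).2.2 hfw₁
  have hnonpos := laplacian_nonpos_of_isLocalMax hlocalC huC2
  linarith

/-! ### 5. The maximum principle on `X₀(N)` with bounded singularities along an orbit -/

/-- **No positive values.** Let `N ≥ 1`, `λ > 0`, `z' ∈ ℍ`, and let `f : ℍ → ℝ` be
`Γ₀(N)`-invariant, `C²` with `y² Δₑ f = λ f` off the orbit `Γ₀(N) z'`, small high in every cusp,
and bounded on a punctured neighbourhood of `z'` (off the orbit). Then `f ≤ 0` off the orbit.
(If `f(z₀) > 0`, then by compactness away from the cusps, finiteness of the orbit points in a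
compact set and the barrier lemma, `f` attains a positive maximum over `ℍ \ Γ₀(N)z'` at an interior
point, where `Δₑ f ≤ 0 < λ f / y²`.) [cite: Zhang1997, §3.4 (uniqueness claim, p. 132)] -/
theorem nonpos_of_invariant_eigen_cusp_bounded {N : ℕ} [NeZero N] {lam : ℝ} (hlam : 0 < lam)
    {z' : ℍ} {f : ℍ → ℝ}
    (hinv : ∀ γ ∈ Gamma0 N, ∀ z : ℍ, f (γ • z) = f z)
    (hC2 : ∀ z : ℍ, z ∉ MulAction.orbit (Gamma0 N) z' →
      ContDiffAt ℝ 2 (fun w : ℂ => f (ofComplex w)) (z : ℂ))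
    (hΔ : ∀ z : ℍ, z ∉ MulAction.orbit (Gamma0 N) z' →
      z.im ^ 2 * Δ (fun w : ℂ => f (ofComplex w)) (z : ℂ) = lam * f z)
    (hcusp : ∀ σ : SL(2, ℤ), ∀ η : ℝ, 0 < η → ∃ B : ℝ, ∀ z : ℍ, B ≤ z.im → |f (σ • z)| ≤ η)
    (hbdd : ∃ C ε : ℝ, 0 < ε ∧ ∀ z : ℍ, dist z z' < ε →
      z ∉ MulAction.orbit (Gamma0 N) z' → |f z| ≤ C) :
    ∀ z : ℍ, z ∉ MulAction.orbit (Gamma0 N) z' → f z ≤ 0 := by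
  set O : Set ℍ := MulAction.orbit (Gamma0 N) z' with hO
  intro z₀ hz₀
  by_contra hz₀pos
  push Not at hz₀pos
  -- the orbit is `Γ₀(N)`-stable
  have hOsmul : ∀ γ ∈ Gamma0 N, ∀ z : ℍ, γ • z ∈ O ↔ z ∈ O := by
    intro γ hγ z
    have e : γ • z = (⟨γ, hγ⟩ : Gamma0 N) • z := rfl
    rw [hO, e, ← MulAction.orbit_eq_iff, MulAction.orbit_smul, MulAction.orbit_eq_iff]
  -- the eigenvalue equation, solved for `Δₑ`
  have hΔ' : ∀ z : ℍ, z ∉ O →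
      Δ (fun w : ℂ => f (ofComplex w)) (z : ℂ) = lam / z.im ^ 2 * f z := by
    intro z hz
    have h := hΔ z hz
    have hi : z.im ^ 2 ≠ 0 := (pow_pos z.im_pos 2).ne'
    field_simp
    linarith
  -- Step 1: compactness away from the cusps, with threshold `η = f z₀ / 2`
  obtain ⟨K, hK, hKcov⟩ := exists_isCompact_of_cusp_decay hinv hcusp (half_pos hz₀pos)
  set K₁ : Set ℍ := cthickening 1 K with hK₁
  have hK₁c : IsCompact K₁ := hK.cthickening
  have hKK₁ : K ⊆ K₁ := self_subset_cthickening K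
  -- Step 2: the finitely many orbit points in `K₁`
  set P : Set ℍ := O ∩ K₁ with hP
  have hPfin : P.Finite := finite_orbit_inter (Gamma0 N) z' hK₁c
  -- Step 3: a common small radius `r`
  obtain ⟨C₀, ε₀, hε₀, hbd⟩ := hbdd
  have hR1 : ∀ᶠ r in 𝓝[>] (0 : ℝ), r < 1 / 2 :=
    (gt_mem_nhds (by norm_num : (0 : ℝ) < 1 / 2)).filter_mono nhdsWithin_le_nhds
  have hR2 : ∀ᶠ r in 𝓝[>] (0 : ℝ), ∀ p ∈ P, ∀ q ∈ P, p ≠ q → 2 * r < dist p q := by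
    refine hPfin.eventually_all.2 fun p _ => hPfin.eventually_all.2 fun q _ => ?_
    by_cases hpq : p = q
    · exact Eventually.of_forall fun r h => absurd hpq h
    · have hd : 0 < dist p q / 2 := half_pos (dist_pos.2 hpq)
      filter_upwards [(gt_mem_nhds hd).filter_mono nhdsWithin_le_nhds] with r hr _
      linarith
  have hR3 : ∀ᶠ r in 𝓝[>] (0 : ℝ), ∀ p ∈ P, ∀ y : ℍ, dist y p ≤ r → y ∈ O → y = p := by
    refine hPfin.eventually_all.2 fun p _ => ?_
    obtain ⟨V, hV, hV'⟩ := exists_nhds_forall_mem_orbit_eq (Gamma0 N) z' p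
    obtain ⟨ε₁, hε₁, hball⟩ := Metric.mem_nhds_iff.1 hV
    filter_upwards [(gt_mem_nhds hε₁).filter_mono nhdsWithin_le_nhds] with r hr y hy hyO
    exact hV' y (hball (mem_ball.2 (hy.trans_lt hr))) hyO
  have hR4 : ∀ᶠ r in 𝓝[>] (0 : ℝ), ∀ p ∈ P, ∀ w : ℍ, dist w p ≤ r → w ∉ O → |f w| ≤ C₀ := by
    refine hPfin.eventually_all.2 fun p hp => ?_
    obtain ⟨γ, hγ⟩ := MulAction.mem_orbit_iff.1 hp.1
    set g : SL(2, ℤ) := (γ : SL(2, ℤ)) with hg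
    have hgΓ : g ∈ Gamma0 N := γ.2
    have hgz : g • z' = p := hγ
    have hginv : g⁻¹ • p = z' := by rw [← hgz, inv_smul_smul]
    -- `w ↦ g⁻¹ w` is continuous at `p` and sends `p` to `z'`
    have hct : Tendsto (fun w : ℍ => g⁻¹ • w) (𝓝 p) (𝓝 z') := by
      have := (continuous_sl_smul g⁻¹).continuousAt (x := p)
      rwa [ContinuousAt, hginv] at this
    have hev : ∀ᶠ w in 𝓝 p, dist (g⁻¹ • w) z' < ε₀ := hct (ball_mem_nhds z' hε₀)
    obtain ⟨ε₁, hε₁, hball⟩ := Metric.eventually_nhds_iff.1 hev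
    filter_upwards [(gt_mem_nhds hε₁).filter_mono nhdsWithin_le_nhds] with r hr w hw hwO
    have h1 : dist (g⁻¹ • w) z' < ε₀ := hball (hw.trans_lt hr)
    have h2 : g⁻¹ • w ∉ O := fun h => hwO ((hOsmul g⁻¹ (inv_mem hgΓ) w).1 h)
    have h3 := hbd (g⁻¹ • w) h1 h2
    rwa [hinv g⁻¹ (inv_mem hgΓ) w] at h3
  obtain ⟨r, hr0, hr1, hr2, hr3, hr4⟩ :
      ∃ r : ℝ, 0 < r ∧ r < 1 / 2 ∧ (∀ p ∈ P, ∀ q ∈ P, p ≠ q → 2 * r < dist p q) ∧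
        (∀ p ∈ P, ∀ y : ℍ, dist y p ≤ r → y ∈ O → y = p) ∧
        (∀ p ∈ P, ∀ w : ℍ, dist w p ≤ r → w ∉ O → |f w| ≤ C₀) := by
    have h0 : ∀ᶠ r in 𝓝[>] (0 : ℝ), 0 < r := eventually_mem_nhdsWithin
    exact (h0.and (hR1.and (hR2.and (hR3.and hR4)))).exists
  -- Step 4: the compact set `K' = K₁ \ ⋃_{p ∈ P} B(p, r)` off the orbit
  set K' : Set ℍ := K₁ \ ⋃ p ∈ P, ball p r with hK'
  have hK'c : IsCompact K' := hK₁c.diff (isOpen_biUnion fun p _ => isOpen_ball)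
  have hK'O : ∀ z ∈ K', z ∉ O := by
    rintro z ⟨hzK₁, hzU⟩ hzO
    exact hzU (mem_biUnion (show z ∈ P from ⟨hzO, hzK₁⟩) (mem_ball_self hr0))
  have hcontK' : ContinuousOn f K' := fun z hz =>
    (continuousAt_of_contDiffAt_comp_ofComplex (hC2 z (hK'O z hz))).continuousWithinAt
  -- points of the spheres `ρ(y, p) = r`, `p ∈ P` within `r` of `K`, lie in `K'`
  have hsphere : ∀ p ∈ P, ∀ w ∈ K, dist w p < r → ∀ y : ℍ, dist y p = r → y ∈ K' := by
    intro p hp w hwK hwp y hy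
    refine ⟨?_, ?_⟩
    · refine mem_cthickening_of_dist_le y w 1 K hwK ?_
      have := dist_triangle y p w
      rw [dist_comm p w] at this
      linarith
    · intro hyU
      obtain ⟨q, hq, hyq⟩ := mem_iUnion₂.1 hyU
      have hyq' : dist y q < r := mem_ball.1 hyq
      by_cases hpq : p = q
      · subst hpq
        linarith
      · have h2 := hr2 p hp q hq hpq
        have := dist_triangle p y q
        rw [dist_comm p y] at this
        linarith
  -- the barrier lemma around a point `p ∈ P` within `r` of `K`, with bound `max M 0`
  have hbarrier : ∀ p ∈ P, ∀ w ∈ K, dist w p < r → ∀ M : ℝ, (∀ y ∈ K', f y ≤ M) →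
      ∀ v : ℍ, 0 < dist v p → dist v p < r → f v ≤ max M 0 := by
    intro p hp w hwK hwp M hM
    refine le_of_forall_sphere_le (c := fun v => lam / v.im ^ 2) (C := C₀) hr0 (le_max_right M 0)
      ?_ ?_ ?_
    · intro v hv hvr
      have hvO : v ∉ O := fun h => (dist_pos.1 hv) (hr3 p hp v hvr h)
      exact ⟨hC2 v hvO, hΔ' v hvO, div_pos hlam (pow_pos v.im_pos 2)⟩
    · intro v hv hvr
      have hvO : v ∉ O := fun h => (dist_pos.1 hv) (hr3 p hp v hvr h)
      exact (le_abs_self _).trans (hr4 p hp v hvr hvO)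
    · intro y hy
      exact (hM y (hsphere p hp w hwK hwp y hy)).trans (le_max_left M 0)
  -- Step 5: every value `f z > f z₀ / 2` off the orbit is dominated by `max M 0`, `M = max_{K'} f`
  have hclaim : ∀ M : ℝ, (∀ y ∈ K', f y ≤ M) →
      ∀ z : ℍ, z ∉ O → f z₀ / 2 < f z → f z ≤ max M 0 := by
    intro M hM z hz hfz
    rcases hKcov z with ⟨γ, hγ, w, hwK, rfl⟩ | hsmall
    · have hwO : w ∉ O := fun h => hz ((hOsmul γ hγ w).2 h)
      rw [hinv γ hγ w] at hfz ⊢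
      by_cases hwU : w ∈ ⋃ p ∈ P, ball p r
      · obtain ⟨p, hp, hwp⟩ := mem_iUnion₂.1 hwU
        have hwp' : dist w p < r := mem_ball.1 hwp
        have hwp0 : 0 < dist w p := dist_pos.2 fun h => hwO (h ▸ hp.1)
        exact hbarrier p hp w hwK hwp' M hM w hwp0 hwp'
      · exact (hM w ⟨hKK₁ hwK, hwU⟩).trans (le_max_left M 0)
    · exfalso
      have := le_abs_self (f z)
      linarith
  -- `K'` is nonempty (it dominates `z₀`), so `f|K'` attains its maximum `M` at some `z₁`
  have hK'ne : K'.Nonempty := by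
    rcases hKcov z₀ with ⟨γ, hγ, w, hwK, hz₀w⟩ | hsmall
    · by_cases hwU : w ∈ ⋃ p ∈ P, ball p r
      · obtain ⟨p, hp, hwp⟩ := mem_iUnion₂.1 hwU
        obtain ⟨y, hy⟩ := exists_dist_eq p hr0.le
        exact ⟨y, hsphere p hp w hwK (mem_ball.1 hwp) y hy⟩
      · exact ⟨w, hKK₁ hwK, hwU⟩
    · exfalso
      have := le_abs_self (f z₀)
      linarith
  obtain ⟨z₁, hz₁K', hz₁max⟩ := hK'c.exists_isMaxOn hK'ne hcontK'
  set M : ℝ := f z₁ with hMdef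
  have hM : ∀ y ∈ K', f y ≤ M := fun y hy => hz₁max hy
  -- `M > 0` (as `0 < f z₀ ≤ max M 0`) and `M` is the maximum of `f` off the orbit
  have hz₀M : f z₀ ≤ max M 0 := hclaim M hM z₀ hz₀ (by linarith)
  have hMpos : 0 < M := by
    by_contra hle
    push Not at hle
    rw [max_eq_right hle] at hz₀M
    linarith
  have hmaxM : max M 0 = M := max_eq_left hMpos.le
  have hz₁O : z₁ ∉ O := hK'O z₁ hz₁K'
  have hglobal : ∀ z : ℍ, z ∉ O → f z ≤ M := by
    intro z hz
    by_cases hfz : f z₀ / 2 < f z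
    · rw [← hmaxM]
      exact hclaim M hM z hz hfz
    · push Not at hfz
      linarith
  -- Step 6: `z₁` is an interior local maximum with `Δₑ f (z₁) = λ f(z₁)/y₁² > 0`: contradiction
  have hlocal : IsLocalMax f z₁ := by
    filter_upwards [(isOpen_compl_orbit (Gamma0 N) z').mem_nhds hz₁O] with z hz
    exact hglobal z hz
  have hlocalC := isLocalMax_comp_ofComplex hlocal
  have hnonpos := laplacian_nonpos_of_isLocalMax hlocalC (hC2 z₁ hz₁O)
  have hpos : 0 < Δ (fun w : ℂ => f (ofComplex w)) (z₁ : ℂ) := by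
    rw [hΔ' z₁ hz₁O]
    exact mul_pos (div_pos hlam (pow_pos z₁.im_pos 2)) hMpos
  linarith

/-- From the cusp condition (c) with `k ≥ 2`, `f(σ z) → 0` as `Im z → ∞`, uniformly in `Re z`.
[folklore] -/
theorem cusp_small_of_cusp_bound {k : ℕ} (hk : 2 ≤ k) {f : ℍ → ℝ} {σ : SL(2, ℤ)}
    (h : ∃ C B : ℝ, ∀ z : ℍ, B ≤ z.im → |f (σ • z)| * z.im ^ (k - 1) ≤ C) (η : ℝ) (hη : 0 < η) :
    ∃ B : ℝ, ∀ z : ℍ, B ≤ z.im → |f (σ • z)| ≤ η := by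
  obtain ⟨C, B, hCB⟩ := h
  refine ⟨max (max B 1) (C / η + 1), fun z hz => ?_⟩
  have hz1 : 1 ≤ z.im := le_trans (le_max_right B 1) ((le_max_left _ _).trans hz)
  have hzB : B ≤ z.im := le_trans (le_max_left B 1) ((le_max_left _ _).trans hz)
  have hzC : C / η < z.im := by linarith [le_max_right (max B 1) (C / η + 1)]
  have h1 := hCB z hzB
  have hpow : z.im ≤ z.im ^ (k - 1) := by
    calc z.im = z.im ^ 1 := (pow_one _).symm
      _ ≤ z.im ^ (k - 1) := pow_le_pow_right₀ hz1 (by omega)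
  have h2 : |f (σ • z)| * z.im ≤ C := le_trans (mul_le_mul_of_nonneg_left hpow (abs_nonneg _)) h1
  by_contra hcon
  push Not at hcon
  have h3 : η * z.im < |f (σ • z)| * z.im := mul_lt_mul_of_pos_right hcon (by linarith)
  have h4 : C < η * z.im := by
    rw [div_lt_iff₀ hη] at hzC
    linarith
  linarith

/-- **One-sided uniqueness**: under the hypotheses of `resolventGreen_unique`, `F₁ ≤ F₂` off the
orbit. [cite: Zhang1997, §3.4 (uniqueness claim, p. 132)] -/
theorem sub_nonpos_of_isResolventGreenLike {N k : ℕ} (hN : 0 < N) (hk : 2 ≤ k) {z' : ℍ}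
    {F₁ F₂ : ℍ → ℝ} (h₁ : IsResolventGreenLike N k z' F₁) (h₂ : IsResolventGreenLike N k z' F₂)
    (hbdd : ∃ C ε : ℝ, 0 < ε ∧ ∀ z : ℍ, dist z z' < ε → z ∉ MulAction.orbit (Gamma0 N) z' →
      |F₁ z - F₂ z| ≤ C) :
    ∀ z : ℍ, z ∉ MulAction.orbit (Gamma0 N) z' → F₁ z - F₂ z ≤ 0 := by
  haveI : NeZero N := ⟨hN.ne'⟩
  have hlam : 0 < (k : ℝ) * ((k : ℝ) - 1) := by
    have hk' : (2 : ℝ) ≤ k := by exact_mod_cast hk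
    nlinarith
  refine nonpos_of_invariant_eigen_cusp_bounded (f := fun z => F₁ z - F₂ z) hlam ?_ ?_ ?_ ?_ hbdd
  · intro γ hγ z
    simp only [h₁.smul_eq γ hγ z, h₂.smul_eq γ hγ z]
  · intro z hz
    exact (h₁.contDiffAt z hz).sub (h₂.contDiffAt z hz)
  · intro z hz
    have e : (fun w : ℂ => F₁ (ofComplex w) - F₂ (ofComplex w)) =
        (fun w : ℂ => F₁ (ofComplex w)) - fun w : ℂ => F₂ (ofComplex w) := rfl
    rw [e, (h₁.contDiffAt z hz).laplacian_sub (h₂.contDiffAt z hz), mul_sub, mul_sub]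
    have e₁ := h₁.laplacian_eq z hz
    have e₂ := h₂.laplacian_eq z hz
    simp only [realHypLaplacian] at e₁ e₂
    rw [e₁, e₂]
  · intro σ η hη
    obtain ⟨C₁, B₁, hCB₁⟩ := h₁.cusp_bound σ
    obtain ⟨C₂, B₂, hCB₂⟩ := h₂.cusp_bound σ
    have hcomb : ∃ C B : ℝ, ∀ z : ℍ, B ≤ z.im →
        |(fun z => F₁ z - F₂ z) (σ • z)| * z.im ^ (k - 1) ≤ C := by
      refine ⟨C₁ + C₂, max B₁ B₂, fun z hz => ?_⟩
      have e₁ := hCB₁ z ((le_max_left _ _).trans hz)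
      have e₂ := hCB₂ z ((le_max_right _ _).trans hz)
      have hy : 0 ≤ z.im ^ (k - 1) := (pow_pos z.im_pos _).le
      calc |F₁ (σ • z) - F₂ (σ • z)| * z.im ^ (k - 1)
          ≤ (|F₁ (σ • z)| + |F₂ (σ • z)|) * z.im ^ (k - 1) :=
            mul_le_mul_of_nonneg_right (abs_sub _ _) hy
        _ ≤ C₁ + C₂ := by rw [add_mul]; exact add_le_add e₁ e₂
    exact cusp_small_of_cusp_bound (f := fun z => F₁ z - F₂ z) hk hcomb η hη

end ResolventGreenUnique

/-- **Uniqueness of the resolvent Green function with prescribed singularity** (Gross–Zagier 1986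
§II.2; Zhang 1997, p. 132: "We claim that these properties characterize `G_k(z, z')` uniquely"):
the named fact `resolventGreen_unique` holds — two `Γ₀(N)`-invariant solutions of
`y²(∂ₓ² + ∂ᵧ²)F = k(k-1)F` off `Γ₀(N)z'` with the cusp behaviour (c), whose difference is bounded
near `z'`, coincide off the orbit (`N ≥ 1`, `k ≥ 2`). Proved by the maximum principle with an
`ε log |z - z'|` barrier at the bounded singularities (see the header of §4 above), in place of
the printed `L²`-negativity of `D`. [cite: Zhang1997, §3.4 (uniqueness claim, p. 132)] -/
theorem resolventGreen_unique_holds : resolventGreen_unique := by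
  intro N k hN hk z' F₁ F₂ h₁ h₂ hbdd z hz
  have h12 := ResolventGreenUnique.sub_nonpos_of_isResolventGreenLike hN hk h₁ h₂ hbdd z hz
  have hbdd' : ∃ C ε : ℝ, 0 < ε ∧ ∀ z : ℍ, dist z z' < ε →
      z ∉ MulAction.orbit (Gamma0 N) z' → |F₂ z - F₁ z| ≤ C := by
    obtain ⟨C, ε, hε, h⟩ := hbdd
    exact ⟨C, ε, hε, fun z hz hzO => by rw [abs_sub_comm]; exact h z hz hzO⟩
  have h21 := ResolventGreenUnique.sub_nonpos_of_isResolventGreenLike hN hk h₂ h₁ hbdd' z hz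
  linarith

end ResolventGreenUniqueProof

end Literature.NumberTheory.Automorphic

end
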